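import Literature.AlgebraicGeometry.HilbertScheme.HilbertSchemeOfPoints
import Literature.AlgebraicGeometry.GroupSchemes.GroupSchemeKernel
import HarnessLib

/-!
# The functor of (stable) closed subgroup schemes of rank `q` of a group scheme — a subfunctor of `Hilb^q_{G/S}`

Layer `Literature/AlgebraicGeometry/GroupSchemes`, namespace `Literature.AlgebraicGeometry.GroupSchemes`.  DEFINITIONS +
their bookkeeping (no theorem of algebraic geometry, no instance, no notation, no named fact, no `sorry`).  Cell
`hodgecm-mathlib` (D-0151), programme P6 «MOD», GENERIC ORGAN L5.3 (MOD-PLAN v0.9 §5; kit desk `F0/P6-kit/IwahoriLevel.desk`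
of A-p07 (g17), 28471a45 — credited: the carrier idea «an `𝒪`-stable finite locally free subgroup scheme `C ⊂ G` of rank `q`»
is his); B-p04 (g36).  Count-neutral Mathlib-side capital: HC_CM is proved only modulo the 7 printed citations until rung 0
closes; nothing here bears on it.

THE PRINT.  [Liu2021] App. D, p. 137 L7–11: «We define a functor `S_{K,Iw}` over `S_K` such that for every `S_K`-scheme
`u : S → S_K`, the set `S_{K,Iw}(S)` consists of `O_𝔭`-stable finite flat `S`-subgroups of `u^*E_∞[𝔭]` of rank `q`. … the
above functor is represented by a finite flat morphism `π : S_{K,Iw} → S_K` of schemes (of degree `q + 1`)».  The Stacks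
Project, Tag 0B94: the Hilbert functor `Hilb^d_{X/S}(T) = {Z ⊂ X_T closed, Z → T finite locally free of degree d}` — in the
tree ★ `HilbertScheme.hilbertFunctorOfPoints d X T` (ideal-sheaf currency: a point is an HONEST ideal sheaf `I` of
`X ×_S T`, base change is `I.comap (X ◁ g)`, B. `HilbertSchemeOfPoints`).

THIS FILE types the GENERIC part of Liu's functor, for ANY `S`-group scheme `G : Over S` (`[GrpObj G]`), any family of
endomorphisms `act : O → (G ⟶ G)` (the `𝒪`-action) and any rank `q`, as a SUBFUNCTOR of `Hilb^q_{G/S}`: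

* §1 `pointsOver I t` — for an ideal sheaf `I` of `G ×_S T` and `t : W ⟶ T`, the set of `W`-valued points `φ : W ⟶ G` of `G`
  whose graph `(φ, t) : W ⟶ G ×_S T` lands in the closed subscheme `Z_I = V(I)` (`I ≤ ker (φ, t)`; factorisation form
  `mem_pointsOver_iff_exists_lift`); **`pointsOver_comap_whiskerLeft`** — the points of the pulled-back family
  `(G ×_S g)^* I` over `t'` are the points of `I` over `t' ≫ g` (so everything below is functorial for free);
* §2 **`IsSubgroupIdeal G T I`** — the points of `Z_I` form a subgroup of the group `W ⟶ G` (Mathlib `Hom.group`) for every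
  `t : W ⟶ T` («`Z_I ⊂ G_T` is a closed subgroup scheme over `T`», functor-of-points form, [GortzWedhorn2020] Def. 4.42 ∕
  (4.15)); `IsSubgroupIdeal.subgroup`; stability under base change `IsSubgroupIdeal.comap_whiskerLeft`;
* §3 **`IsStableIdeal act T I`** — the points of `Z_I` are stable under `φ ↦ φ ≫ act a` («`𝒪`-stable»); base change;
* §4 **`stableSubgroupFunctorOfPoints q G act T ⊆ hilbertFunctorOfPoints q G T`** — Liu's `S_{K,Iw}(T)` for
  `(G, act, q) := (u^*E_∞[𝔭], 𝒪_𝔭, q)`: ideals `I` with `Z_I → T` finite locally free of rank `q`, `IsSubgroupIdeal`,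
  `IsStableIdeal`; **`comap_whiskerLeft_mem_stableSubgroupFunctorOfPoints`** (it IS a functor on `(Sch/S)ᵒᵖ`); the case of
  no action is `O` empty (`isStableIdeal_of_isEmpty`);
* §5 the representability PREDICATE **`IsStableSubgroupModuli q G act M Θ`** («`(M, Θ)` represents Liu's functor»:
  `Θ ∈ S_{Iw}(M)` and every `I ∈ S_{Iw}(T)` is `(G ×_S g)^*Θ` for a unique `g : T ⟶ M`), mirroring ★
  `IsHilbertSchemeOfPoints`, with `hom_ext ∕ lift ∕ comap_lift ∕ eq_lift ∕ lift_self ∕ exists_iso` (Yoneda uniqueness).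

NOT HERE: existence.  The sequel `GroupSchemes/SubgroupSchemeModuliClosed` proves that the two conditions are CLOSED on
any Hilbert scheme of `q` points of `G/S` (★ `Morphisms/ContainmentLocusFiniteFlat`), so that `IsHilbertSchemeOfPoints q G H Ξ`
yields `IsStableSubgroupModuli q G act M Θ` on a closed subscheme `M ⊆ H`; the existence of `Hilb^q_{G/S}` for `G → S`
finite locally free, and Liu's «finite flat of degree `q + 1`» (deformation theory of the 1-dimensional formal
`𝒪`-module `E_∞`), are separate organs.

## References
* [Liu2021] Y. Liu, *Fourier–Jacobi cycles and arithmetic relative trace formula*, Camb. J. Math. 9 (2021), App. D, p. 137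
  L7–11 (the functor `S_{K,Iw}`).
* [StacksProject] The Stacks Project, Tag 0B94 (Hilbert functor of points), Tag 01QN ∕ 01QO (closed immersions and
  ideal sheaves).
* [GortzWedhorn2020] U. Görtz, T. Wedhorn, *Algebraic Geometry I*, 2nd ed. (2020), Def. 4.42, (4.15) (group schemes, their
  points and base change, pp. 116–117); Section (4.11) (closed subschemes and quasi-coherent ideals).
-/

noncomputable section

-- Mathlib's `Over`/pull-back API is stated across semireducible wrappers (as in the ★ `GroupSchemes/*` files).
set_option backward.isDefEq.respectTransparency false

open CategoryTheory CategoryTheory.Limits AlgebraicGeometry MonoidalCategory CartesianMonoidalCategory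
open scoped MonObj

universe v u

namespace Literature.AlgebraicGeometry.GroupSchemes

open Literature.AlgebraicGeometry.HilbertScheme

variable {S : Scheme.{u}}

/-! ## §1 Points of a closed subscheme `Z_I ⊂ G ×_S T` over `t : W ⟶ T` -/

section Points

variable {G T : Over S}

/-- A morphism `h ≫ f` lands in the closed subscheme `V(I)` iff `h` lands in `V(f^* I)`: `I ≤ ker (h ≫ f) ↔ I.comap f ≤ ker h`
(Mathlib's Galois connection `comap ⊣ map` and `ker (h ≫ f) = (ker h).map f`). [cite: StacksProject, Tag 01QO] -/
theorem le_ker_comp_iff_comap_le {W X Y : Scheme.{u}} (I : Y.IdealSheafData) (h : W ⟶ X) (f : X ⟶ Y) :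
    I ≤ (h ≫ f).ker ↔ I.comap f ≤ h.ker := by
  rw [Scheme.Hom.ker_comp, Scheme.IdealSheafData.le_map_iff_comap_le]

/-- **The `W`-valued points of `Z_I ⊂ G ×_S T` over `t : W ⟶ T`**: for an ideal sheaf `I` of `G ×_S T` (a closed subscheme
`Z_I = V(I)`), the set of `S`-morphisms `φ : W ⟶ G` whose graph `(φ, t) : W ⟶ G ×_S T` factors through `Z_I`, i.e.
`I ≤ ker (φ, t)`.  These are the `W`-valued points of the `T`-scheme `Z_I` lying over `t`, read inside `G(W)`.
[cite: GortzWedhorn2020, Definition 4.42 and (4.15), pp. 116–117] [cite: StacksProject, Tag 0B94] -/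
def pointsOver (I : (G ⊗ T).left.IdealSheafData) {W : Over S} (t : W ⟶ T) : Set (W ⟶ G) :=
  {φ | I ≤ (lift φ t).left.ker}

/-- Membership in `pointsOver I t`, unfolded. [cite: StacksProject, Tag 0B94] -/
theorem mem_pointsOver_iff (I : (G ⊗ T).left.IdealSheafData) {W : Over S} (t : W ⟶ T) (φ : W ⟶ G) :
    φ ∈ pointsOver I t ↔ I ≤ (lift φ t).left.ker :=
  Iff.rfl

/-- **Factorisation form**: `φ ∈ pointsOver I t` iff the graph `(φ, t)` factors through the closed immersion `Z_I ↪ G ×_S T`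
(universal property of closed immersions, Mathlib `IsClosedImmersion.lift`). [cite: StacksProject, Tag 01QO] -/
theorem mem_pointsOver_iff_exists_lift (I : (G ⊗ T).left.IdealSheafData) {W : Over S} (t : W ⟶ T) (φ : W ⟶ G) :
    φ ∈ pointsOver I t ↔ ∃ k : W.left ⟶ I.subscheme, k ≫ I.subschemeι = (lift φ t).left := by
  constructor
  · intro h
    have h' : I.subschemeι.ker ≤ (lift φ t).left.ker := by rwa [Scheme.IdealSheafData.ker_subschemeι]
    exact ⟨IsClosedImmersion.lift I.subschemeι (lift φ t).left h', IsClosedImmersion.lift_fac _ _ _⟩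
  · rintro ⟨k, hk⟩
    rw [mem_pointsOver_iff, ← hk]
    calc I = I.subschemeι.ker := I.ker_subschemeι.symm
      _ ≤ (k ≫ I.subschemeι).ker := Scheme.Hom.le_ker_comp _ _

/-- **Base change of points**: for `g : T' ⟶ T` and `t' : W ⟶ T'`, the points of the pulled-back family `(G ×_S g)^* I` over `t'`
are exactly the points of `I` over `t' ≫ g` (`(φ, t') ≫ (G ×_S g) = (φ, t' ≫ g)`).  This is why every condition below is
stable under base change. [cite: StacksProject, Tag 0B94] [cite: GortzWedhorn2020, Definition 4.42 and (4.15), pp. 116–117] -/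
theorem pointsOver_comap_whiskerLeft (I : (G ⊗ T).left.IdealSheafData) {T' : Over S} (g : T' ⟶ T) {W : Over S}
    (t' : W ⟶ T') : pointsOver (I.comap (G ◁ g).left) t' = pointsOver I (t' ≫ g) := by
  ext φ
  rw [mem_pointsOver_iff, mem_pointsOver_iff, ← le_ker_comp_iff_comap_le, ← Over.comp_left, lift_whiskerLeft]

/-- Points over `t` transported along `c : W' ⟶ W`: if `φ ∈ pointsOver I t` then `c ≫ φ ∈ pointsOver I (c ≫ t)`.
[cite: GortzWedhorn2020, Definition 4.42 and (4.15), pp. 116–117] -/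
theorem comp_mem_pointsOver {I : (G ⊗ T).left.IdealSheafData} {W W' : Over S} {t : W ⟶ T} {φ : W ⟶ G}
    (hφ : φ ∈ pointsOver I t) (c : W' ⟶ W) : c ≫ φ ∈ pointsOver I (c ≫ t) := by
  rw [mem_pointsOver_iff, ← comp_lift, Over.comp_left]
  exact hφ.trans (Scheme.Hom.le_ker_comp _ _)

end Points

/-! ## §2 «`Z_I` is a closed subgroup scheme of `G_T`» — functor-of-points form -/

section Subgroup

variable (G : Over S) [GrpObj G] (T : Over S)

/-- **`Z_I ⊂ G ×_S T` is a (closed) SUBGROUP scheme over `T`**, functor-of-points form: for every `t : W ⟶ T` the `W`-valued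
points of `Z_I` over `t` form a subgroup of the group `G(W) = (W ⟶ G)` (Mathlib `Hom.group` of the group object `G` of
`Over S`) — they contain `1`, are closed under products and under inverses.  (By Yoneda this is the statement that the unit,
the multiplication and the inversion of the `T`-group scheme `G_T` restrict to `Z_I`; the sequel
`SubgroupSchemeModuliClosed` reads it on three universal test objects.) [cite: GortzWedhorn2020, Definition 4.42 and (4.15), pp. 116–117]
[cite: Liu2021, Appendix D, p. 137 L7–11] -/
structure IsSubgroupIdeal (I : (G ⊗ T).left.IdealSheafData) : Prop where
  /-- the unit point lies in `Z_I` over every `t` -/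
  one_mem : ∀ ⦃W : Over S⦄ (t : W ⟶ T), (1 : W ⟶ G) ∈ pointsOver I t
  /-- points of `Z_I` over `t` are closed under the product of `G(W)` -/
  mul_mem : ∀ ⦃W : Over S⦄ (t : W ⟶ T) ⦃φ ψ : W ⟶ G⦄,
    φ ∈ pointsOver I t → ψ ∈ pointsOver I t → φ * ψ ∈ pointsOver I t
  /-- points of `Z_I` over `t` are closed under inversion in `G(W)` -/
  inv_mem : ∀ ⦃W : Over S⦄ (t : W ⟶ T) ⦃φ : W ⟶ G⦄, φ ∈ pointsOver I t → φ⁻¹ ∈ pointsOver I t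

namespace IsSubgroupIdeal

variable {G T} {I : (G ⊗ T).left.IdealSheafData}

/-- The subgroup `Z_I(W, t) ≤ G(W)` of points of a subgroup ideal over `t : W ⟶ T`.
[cite: GortzWedhorn2020, Definition 4.42 and (4.15), pp. 116–117] -/
def subgroup (h : IsSubgroupIdeal G T I) {W : Over S} (t : W ⟶ T) : Subgroup (W ⟶ G) where
  carrier := pointsOver I t
  one_mem' := h.one_mem t
  mul_mem' hφ hψ := h.mul_mem t hφ hψ
  inv_mem' hφ := h.inv_mem t hφ

/-- The carrier of `h.subgroup t` is `pointsOver I t`. [cite: GortzWedhorn2020, Definition 4.42 and (4.15), pp. 116–117] -/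
theorem mem_subgroup_iff (h : IsSubgroupIdeal G T I) {W : Over S} (t : W ⟶ T) (φ : W ⟶ G) :
    φ ∈ h.subgroup t ↔ φ ∈ pointsOver I t :=
  Iff.rfl

/-- **Subgroup ideals are stable under base change**: if `Z_I ⊂ G_T` is a subgroup scheme then so is
`Z_I ×_T T' = Z_{(G ×_S g)^* I} ⊂ G_{T'}` for every `g : T' ⟶ T`. [cite: GortzWedhorn2020, Definition 4.42 and (4.15), pp. 116–117]
[cite: StacksProject, Tag 0B94] -/
theorem comap_whiskerLeft (h : IsSubgroupIdeal G T I) {T' : Over S} (g : T' ⟶ T) :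
    IsSubgroupIdeal G T' (I.comap (G ◁ g).left) where
  one_mem W t' := by
    rw [pointsOver_comap_whiskerLeft]
    exact h.one_mem (t' ≫ g)
  mul_mem W t' φ ψ hφ hψ := by
    rw [pointsOver_comap_whiskerLeft] at hφ hψ ⊢
    exact h.mul_mem (t' ≫ g) hφ hψ
  inv_mem W t' φ hφ := by
    rw [pointsOver_comap_whiskerLeft] at hφ ⊢
    exact h.inv_mem (t' ≫ g) hφ

end IsSubgroupIdeal

end Subgroup

/-! ## §3 «`Z_I` is stable under the endomorphisms `act a`» -/

section Stable

variable {G : Over S} {O : Type v} (act : O → (G ⟶ G)) (T : Over S)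

/-- **`Z_I ⊂ G ×_S T` is `act`-STABLE** (Liu's «`O_𝔭`-stable»; the kit's factorisation `act_C a ≫ j = j ≫ act a` in
functor-of-points form): for every `t : W ⟶ T`, every point `φ` of `Z_I` over `t` and every `a`, the translate `φ ≫ act a` is
again a point of `Z_I` over `t`. [cite: Liu2021, Appendix D, p. 137 L7–11] [cite: GortzWedhorn2020, Definition 4.42 and (4.15), pp. 116–117] -/
def IsStableIdeal (I : (G ⊗ T).left.IdealSheafData) : Prop :=
  ∀ ⦃W : Over S⦄ (t : W ⟶ T) ⦃φ : W ⟶ G⦄, φ ∈ pointsOver I t → ∀ a : O, φ ≫ act a ∈ pointsOver I t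

variable {act T}

/-- With no endomorphisms prescribed (`O` empty) every family is stable. [cite: Liu2021, Appendix D, p. 137 L7–11] -/
theorem isStableIdeal_of_isEmpty [IsEmpty O] (I : (G ⊗ T).left.IdealSheafData) : IsStableIdeal act T I :=
  fun _ _ _ _ a => isEmptyElim a

/-- **Stability is preserved by base change.** [cite: Liu2021, Appendix D, p. 137 L7–11] [cite: StacksProject, Tag 0B94] -/
theorem IsStableIdeal.comap_whiskerLeft {I : (G ⊗ T).left.IdealSheafData} (h : IsStableIdeal act T I) {T' : Over S}
    (g : T' ⟶ T) : IsStableIdeal act T' (I.comap (G ◁ g).left) := by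
  intro W t' φ hφ a
  rw [pointsOver_comap_whiskerLeft] at hφ ⊢
  exact h (t' ≫ g) hφ a

end Stable

/-! ## §4 Liu's functor `S_{Iw}(T)`: stable closed subgroup schemes of `G_T`, finite locally free of rank `q` over `T` -/

section Functor

variable (q : ℕ) (G : Over S) [GrpObj G] {O : Type v} (act : O → (G ⟶ G)) (T : Over S)

/-- **The functor of `act`-stable closed subgroup schemes of rank `q`**, on `T`-points (Liu's `S_{K,Iw}(S)` for
`G := u^*E_∞[𝔭]`, `act :=` the `O_𝔭`-action, read over the base `S_K`): the ideal sheaves `I` of `G ×_S T` such that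
`Z_I → T` is finite locally free of rank `q` (`I ∈ Hilb^q_{G/S}(T)`, ★ `hilbertFunctorOfPoints`), `Z_I` is a subgroup scheme
of `G_T` (`IsSubgroupIdeal`) and `Z_I` is `act`-stable (`IsStableIdeal`).  A SUBSET of `Hilb^q_{G/S}(T)`
(`stableSubgroupFunctorOfPoints_subset`). [cite: Liu2021, Appendix D, p. 137 L7–11] [cite: StacksProject, Tag 0B94] -/
def stableSubgroupFunctorOfPoints : Set (G ⊗ T).left.IdealSheafData :=
  {I | I ∈ hilbertFunctorOfPoints q G T ∧ IsSubgroupIdeal G T I ∧ IsStableIdeal act T I}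

variable {q G act T}

/-- Membership in `S_{Iw}(T)`, unfolded. [cite: Liu2021, Appendix D, p. 137 L7–11] -/
theorem mem_stableSubgroupFunctorOfPoints_iff (I : (G ⊗ T).left.IdealSheafData) :
    I ∈ stableSubgroupFunctorOfPoints q G act T ↔
      I ∈ hilbertFunctorOfPoints q G T ∧ IsSubgroupIdeal G T I ∧ IsStableIdeal act T I :=
  Iff.rfl

/-- `S_{Iw}(T) ⊆ Hilb^q_{G/S}(T)`. [cite: Liu2021, Appendix D, p. 137 L7–11] [cite: StacksProject, Tag 0B94] -/
theorem stableSubgroupFunctorOfPoints_subset :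
    stableSubgroupFunctorOfPoints q G act T ⊆ hilbertFunctorOfPoints q G T :=
  fun _ h => h.1

/-- **`S_{Iw}` is a functor on `(Sch/S)ᵒᵖ`** (a subfunctor of `Hilb^q_{G/S}`): for `g : T' ⟶ T` and `I ∈ S_{Iw}(T)` the pulled-back
family `(G ×_S g)^* I` lies in `S_{Iw}(T')` (★ `comap_whiskerLeft_mem` for the rank, §§2–3 for the two conditions).
[cite: Liu2021, Appendix D, p. 137 L7–11] [cite: StacksProject, Tag 0B94] -/
theorem comap_whiskerLeft_mem_stableSubgroupFunctorOfPoints {I : (G ⊗ T).left.IdealSheafData}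
    (hI : I ∈ stableSubgroupFunctorOfPoints q G act T) {T' : Over S} (g : T' ⟶ T) :
    I.comap (G ◁ g).left ∈ stableSubgroupFunctorOfPoints q G act T' :=
  ⟨comap_whiskerLeft_mem hI.1 g, hI.2.1.comap_whiskerLeft g, hI.2.2.comap_whiskerLeft g⟩

end Functor

/-! ## §5 The representability predicate: `(M, Θ)` represents `S_{Iw}` -/

/-- **`(M, Θ)` REPRESENTS Liu's functor of `act`-stable rank-`q` closed subgroup schemes of `G`** (print: «the above functor is
represented by a … morphism `π : S_{K,Iw} → S_K` of schemes»): `Θ ∈ S_{Iw}(M)` (the universal stable subgroup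
`Z_Θ ⊂ G ×_S M`) and every `I ∈ S_{Iw}(T)` is `(G ×_S g)^* Θ` for a UNIQUE `S`-morphism `g : T ⟶ M` — i.e. `g ↦ g^*Θ` is an
isomorphism `h_M ≅ S_{Iw}` on `(Sch/S)ᵒᵖ`.  Mirrors ★ `IsHilbertSchemeOfPoints`; existence is NOT part of the predicate (the
sequel produces it on a closed subscheme of any Hilbert scheme of `q` points of `G/S`).
[cite: Liu2021, Appendix D, p. 137 L7–11] [cite: StacksProject, Tag 0B94] -/
structure IsStableSubgroupModuli (q : ℕ) (G : Over S) [GrpObj G] {O : Type v} (act : O → (G ⟶ G)) (M : Over S)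
    (Θ : (G ⊗ M).left.IdealSheafData) : Prop where
  /-- the universal family is an `M`-point of `S_{Iw}` -/
  mem : Θ ∈ stableSubgroupFunctorOfPoints q G act M
  /-- every `T`-point of `S_{Iw}` is the pull-back of `Θ` along a unique `S`-morphism `T ⟶ M` -/
  existsUnique_hom : ∀ (T : Over S), ∀ I ∈ stableSubgroupFunctorOfPoints q G act T,
    ∃! g : T ⟶ M, Θ.comap (G ◁ g).left = I

namespace IsStableSubgroupModuli

variable {q : ℕ} {G : Over S} [GrpObj G] {O : Type v} {act : O → (G ⟶ G)} {M : Over S}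
  {Θ : (G ⊗ M).left.IdealSheafData}

/-- Two `S`-morphisms `T ⟶ M` pulling the universal family back to the same subgroup are equal.
[cite: Liu2021, Appendix D, p. 137 L7–11] [cite: StacksProject, Tag 0B94] -/
theorem hom_ext (h : IsStableSubgroupModuli q G act M Θ) {T : Over S} {g₁ g₂ : T ⟶ M}
    (hg : Θ.comap (G ◁ g₁).left = Θ.comap (G ◁ g₂).left) : g₁ = g₂ :=
  (h.existsUnique_hom T _ (comap_whiskerLeft_mem_stableSubgroupFunctorOfPoints h.mem g₂)).unique hg rfl

/-- **The classifying morphism** `T ⟶ M` of a stable subgroup `I ∈ S_{Iw}(T)`. [cite: Liu2021, Appendix D, p. 137 L7–11]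
[cite: StacksProject, Tag 0B94] -/
def lift (h : IsStableSubgroupModuli q G act M Θ) (T : Over S) (I : (G ⊗ T).left.IdealSheafData)
    (hI : I ∈ stableSubgroupFunctorOfPoints q G act T) : T ⟶ M :=
  (h.existsUnique_hom T I hI).exists.choose

/-- The classifying morphism pulls the universal family back to the given one. [cite: StacksProject, Tag 0B94] -/
theorem comap_lift (h : IsStableSubgroupModuli q G act M Θ) (T : Over S) (I : (G ⊗ T).left.IdealSheafData)
    (hI : I ∈ stableSubgroupFunctorOfPoints q G act T) : Θ.comap (G ◁ h.lift T I hI).left = I :=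
  (h.existsUnique_hom T I hI).exists.choose_spec

/-- Any morphism pulling `Θ` back to `I` is the classifying morphism of `I`. [cite: StacksProject, Tag 0B94] -/
theorem eq_lift (h : IsStableSubgroupModuli q G act M Θ) {T : Over S} {I : (G ⊗ T).left.IdealSheafData}
    (hI : I ∈ stableSubgroupFunctorOfPoints q G act T) {g : T ⟶ M} (hg : Θ.comap (G ◁ g).left = I) :
    g = h.lift T I hI :=
  h.hom_ext (hg.trans (h.comap_lift T I hI).symm)

/-- The universal family is classified by the identity. [cite: StacksProject, Tag 0B94] -/
theorem lift_self (h : IsStableSubgroupModuli q G act M Θ) : h.lift M Θ h.mem = 𝟙 M :=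
  (h.eq_lift h.mem (IsHilbertSchemeOfPoints.comap_whiskerLeft_id Θ)).symm

/-- **Uniqueness of the moduli scheme** (Yoneda): two representing pairs are isomorphic over `S` by an isomorphism
exchanging the universal families. [cite: Liu2021, Appendix D, p. 137 L7–11] [cite: StacksProject, Tag 0B94] -/
theorem exists_iso {M' : Over S} {Θ' : (G ⊗ M').left.IdealSheafData} (h : IsStableSubgroupModuli q G act M Θ)
    (h' : IsStableSubgroupModuli q G act M' Θ') :
    ∃ e : M ≅ M', Θ'.comap (G ◁ e.hom).left = Θ ∧ Θ.comap (G ◁ e.inv).left = Θ' := by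
  refine ⟨⟨h'.lift M Θ h.mem, h.lift M' Θ' h'.mem, ?_, ?_⟩, h'.comap_lift M Θ h.mem, h.comap_lift M' Θ' h'.mem⟩
  · apply h.hom_ext
    rw [IsHilbertSchemeOfPoints.comap_whiskerLeft_comp, h.comap_lift, h'.comap_lift,
      IsHilbertSchemeOfPoints.comap_whiskerLeft_id]
  · apply h'.hom_ext
    rw [IsHilbertSchemeOfPoints.comap_whiskerLeft_comp, h'.comap_lift, h.comap_lift,
      IsHilbertSchemeOfPoints.comap_whiskerLeft_id]

/-- A representing pair is in particular a SUB-pair of a Hilbert functor point: `Θ ∈ Hilb^q_{G/S}(M)`.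
[cite: StacksProject, Tag 0B94] -/
theorem mem_hilbertFunctorOfPoints (h : IsStableSubgroupModuli q G act M Θ) : Θ ∈ hilbertFunctorOfPoints q G M :=
  h.mem.1

end IsStableSubgroupModuli

end Literature.AlgebraicGeometry.GroupSchemes

end
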